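import Summits.Ventures.GridStability.Bench.NE39SPLineSwitchA
import Summits.Ventures.GridStability.Bench.NE39SPLineSwitchB
import Summits.Ventures.GridStability.Bench.NE39SPLineSwitchC
import Summits.Ventures.GridStability.Bench.NE39SPLineSwitchD
import Summits.Ventures.GridStability.Bench.NE39SPLineSwitchE
import Summits.Ventures.GridStability.Bench.NE39SPLineSwitchF
import Summits.Ventures.GridStability.Bench.NE39SPLineSwitchG
import HarnessLib

/-!
# GridStability/Bench/NE39SPLineSwitchAll — the COMPLETE N−1 branch classification of the 49-node
# STRUCTURE-PRESERVING New England instance (column LF): every one of the 56 listed couplings is EITHER a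
# machine reactance (10), OR its opening islands a bus/machine (11, certified cut), OR it carries a kernel
# switching certificate (35/35) — and a uniform transient machine-speed bound

Cell `gridfusion` (LADDER-GRIDFUSION), seat gridfusion-lyap-1 (g9), line «G2.b-NE39SP-N1-SWITCH» (lead g9 RULING 9bw:
«35/35 connected single-branch outages» = ONE further THM-type row when the last instance file lands). INSTANCE OF RECORD
BY NAME: model-2's `Models/NE39SP.lean` (data model-4 sp49.json fddec35dcf838149 = [cite: Padiyar2013, App. D]);
instance files `Bench/NE39SPLineSwitchA…G.lean` (per-branch certificates `certNN`, `checkNN`, `openNN_resync`) and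
`Bench/NE39SPSwitchDefs.lean` (`wOpen`, `paramsOpen`, `switch_resync_open`). NO NEW CERTIFICATE DATA: the only new
literals are the three edge-index classes and the eleven ISLAND node sets (the connected component split off when an
islanding branch opens), checked by `decide`.

THREE COLUMNS. CERTIFIED (kernel): `branch_trichotomy` / `card_classes` (the 56 listed couplings split into EXACTLY ONE of three
classes, 35 + 11 + 10); `machineBranch_iff` (class 3 = exactly the couplings into a machine internal node); `islanding_not_preconnected`
(for each of the 11 branches of class 2 and every `D`, the post-switch coupling graph is NOT preconnected — a certified cut,
so NO synchronous state of the whole model exists to return to: out of the switching theorem's scope BY PROOF, not by fiat);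
`exists_cert_of_mem_switchable` (each of the 35 branches of class 1 carries a certificate with `R = 10⁻⁶`, `τγ = 21/100`,
`c ≤ 123/100` passing `Cert.check`); **`n1_switch_resync`** (the uniform sentence: for EVERY switchable branch and EVERY `D > 0`,
existence of the post-switch synchronous state within `10⁻⁶` rad of a typed half-angle point, coupled branches inside
`2·arctan(21/100)`, and re-synchronisation of every solution from the pre-switch synchronous state with `V ≤ 123/100` throughout);
`speed_le_of_resync` / **`n1_machine_speed_bound`** (along those solutions every machine frequency deviation obeys
`|δ̇ᵢ(t)| ≤ √(2c/Mᵢ)` for all `t ≥ 0` — kinetic energy `≤ V ≤ c`, potential `≥ 0` on the polytope). MODELLED: model-2's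
tokens «MV-3 + lossless + MV-P + D(∀) + ω_s declared + V-frozen(LF) + |E|′(h12)» + «branch opened at t = 0 WITHOUT fault,
no reclosure / protection, magnitudes frozen at the pre-switch load flow after the switch». VALIDATED: nothing (no printed
time-domain study of this model). No sentence of this file says the New England system is stable or N−1 secure.
Three small `Finset` definitions + one island table; no named fact; standard axioms.
-/

noncomputable section

open Set Filter Topology Real Finset
open Summit.Ventures.GridStability.Models
open Summit.Ventures.GridStability.Models.StructurePreserving
open Summit.Ventures.GridStability.Models.NE39SP
open Summit.Ventures.GridStability.Lyapunov.StructurePreserving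
open Summit.Ventures.GridStability.Lyapunov.StructurePreserving.Switch

namespace Summit.Ventures.GridStability.Bench.NE39SP

/-! ### The three classes of listed couplings -/

/-- **Class 1 — switchable branches**: the 35 listed lines/transformers whose opening keeps the coupling graph
connected (each carries a certificate in files A–G). [folklore] -/
def switchable : Finset (Fin 56) := {2, 3, 21, 22, 23, 24, 25, 26, 27, 28, 29, 30, 31, 32, 33, 34, 35, 36, 37, 38, 39, 40, 41, 42, 43, 44, 45, 46, 48, 49, 50, 51, 52, 53, 55}

/-- **Class 2 — islanding branches**: the 11 listed branches whose opening splits off a bus or a machine. [folklore] -/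
def islanding : Finset (Fin 56) := {0, 5, 7, 9, 11, 13, 15, 17, 19, 47, 54}

/-- **Class 3 — machine reactances**: the 10 listed couplings `x′_d` into a machine internal node (not switchgear). [folklore] -/
def machineBranch : Finset (Fin 56) := {1, 4, 6, 8, 10, 12, 14, 16, 18, 20}

/-- **Trichotomy**: every listed coupling belongs to EXACTLY ONE of the three classes (one `decide`). [folklore] -/
theorem branch_trichotomy : ∀ e : Fin 56,
    (e ∈ switchable ∧ e ∉ islanding ∧ e ∉ machineBranch) ∨
      (e ∉ switchable ∧ e ∈ islanding ∧ e ∉ machineBranch) ∨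
      (e ∉ switchable ∧ e ∉ islanding ∧ e ∈ machineBranch) := by
  decide +kernel

/-- Class sizes `35 + 11 + 10 = 56`. [folklore] -/
theorem card_classes : switchable.card = 35 ∧ islanding.card = 11 ∧ machineBranch.card = 10 := by
  decide +kernel

/-- Class 3 is EXACTLY the set of couplings whose target is a machine internal node (model-2's `genS`). [folklore] -/
theorem machineBranch_iff : ∀ e : Fin 56, e ∈ machineBranch ↔ NE39SP.tgtV e ∈ NE39SP.genS := by
  decide +kernel

/-! ### Class 2: opening an islanding branch disconnects the model (certified cuts) -/

/-- **A cut refutes preconnectedness** (generic): if a node set `S` and its complement are both inhabited and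
no nonzero coupling crosses `S`, the coupling graph is not preconnected (membership of `S` is invariant along
every walk). [folklore] -/
theorem not_preconnected_of_cut {n : ℕ} (p : Params n) (hbs : ∀ i j, p.b i j = p.b j i) (S : Finset (Fin n))
    {u v : Fin n} (hu : u ∈ S) (hv : v ∉ S) (hcut : ∀ i j, p.b i j ≠ 0 → (i ∈ S ↔ j ∈ S)) :
    ¬ p.couplingGraph.Preconnected := by
  intro h
  have key : ∀ (a b : Fin n), p.couplingGraph.Walk a b → a ∈ S → b ∈ S := by
    intro a b w
    induction w with
    | nil => exact id
    | cons hadj _ ih =>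
      intro ha
      exact ih ((hcut _ _ ((p.couplingGraph_adj_of_symm hbs _ _).mp hadj).2).mp ha)
  obtain ⟨w⟩ := h u v
  exact hv (key u v w hu)

/-- The ISLAND node sets: for each islanding branch `k`, the smaller of the two connected components created when `k`
opens (bookkeeping table; `∅` off class 2). [folklore] -/
def islandSide : Fin 56 → Finset (Fin 49) := fun k =>
    if k = 0 then {0, 39} else
    if k = 5 then {2, 41} else
    if k = 7 then {3, 42} else
    if k = 9 then {4, 43} else
    if k = 11 then {5, 44} else
    if k = 13 then {6, 45} else
    if k = 15 then {7, 46} else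
    if k = 17 then {8, 47} else
    if k = 19 then {9, 48} else
    if k = 47 then {3, 29, 42} else
    if k = 54 then {3, 4, 29, 38, 42, 43} else ∅

/-- **The cut checks** (one `decide`): for every islanding branch `k`, the island and its complement are
inhabited and no post-switch coupling of `wOpen k` crosses the island. CERTIFIED column. [folklore] -/
theorem islandCut_checks : ∀ k ∈ islanding,
    (∃ u : Fin 49, u ∈ islandSide k) ∧ (∃ v : Fin 49, v ∉ islandSide k) ∧
      ∀ e : Fin 56, wOpen k e ≠ 0 → (NE39SP.srcV e ∈ islandSide k ↔ NE39SP.tgtV e ∈ islandSide k) := by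
  decide +kernel

/-- **Class 2 certified**: opening any of the 11 islanding branches leaves the post-switch model `paramsOpen k D`
with a DISCONNECTED coupling graph (for every `D`) — no synchronous state of the whole model to return to; these
outages are outside the switching theorem's hypotheses by proof. [folklore] -/
theorem islanding_not_preconnected : ∀ k ∈ islanding, ∀ D : Fin 49 → ℝ,
    ¬ (paramsOpen k D).couplingGraph.Preconnected := by
  intro k hk D
  obtain ⟨⟨u, hu⟩, ⟨v, hv⟩, hcut⟩ := islandCut_checks k hk
  refine not_preconnected_of_cut (paramsOpen k D) (fun i j => symmetrize_symm _ i j) (islandSide k) hu hv ?_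
  intro i j hij
  rw [paramsOpen_b] at hij
  obtain ⟨e, hwe, hor⟩ := exists_ne_zero_edge NE39SP.srcV NE39SP.tgtV (fun e => (wOpen k e : ℝ)) hij
  have hwe' : wOpen k e ≠ 0 := fun h => hwe (by simp [h])
  have hiff := hcut e hwe'
  rcases hor with ⟨hs, ht⟩ | ⟨hs, ht⟩
  · subst hs; subst ht; exact hiff
  · subst hs; subst ht; exact hiff.symm

/-! ### Class 1: every switchable branch carries a certificate (files A–G) -/

/-- **35/35**: every switchable branch `k` carries a rational switching certificate with enclosure radius
`R = 10⁻⁶`, margin tangent `τγ = 21/100` and energy level `c ≤ 123/100` that PASSES `Cert.check` against the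
post-switch weights `wOpen k` (the 35 `checkNN` theorems of files A–G, collected). CERTIFIED column. [folklore] -/
theorem exists_cert_of_mem_switchable : ∀ k ∈ switchable, ∃ C : Cert 49 56,
    C.R = 1 / 1000000 ∧ C.τγ = 21 / 100 ∧ C.c ≤ 123/100 ∧
      C.check NE39SP.srcV NE39SP.tgtV NE39SP.wtLFQ (wOpen k) NE39SP.tLFQ 39 := by
  intro k hk
  fin_cases hk
  exacts [⟨cert02, rfl, rfl, by decide +kernel, check02⟩,
    ⟨cert03, rfl, rfl, by decide +kernel, check03⟩,
    ⟨cert21, rfl, rfl, by decide +kernel, check21⟩,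
    ⟨cert22, rfl, rfl, by decide +kernel, check22⟩,
    ⟨cert23, rfl, rfl, by decide +kernel, check23⟩,
    ⟨cert24, rfl, rfl, by decide +kernel, check24⟩,
    ⟨cert25, rfl, rfl, by decide +kernel, check25⟩,
    ⟨cert26, rfl, rfl, by decide +kernel, check26⟩,
    ⟨cert27, rfl, rfl, by decide +kernel, check27⟩,
    ⟨cert28, rfl, rfl, by decide +kernel, check28⟩,
    ⟨cert29, rfl, rfl, by decide +kernel, check29⟩,
    ⟨cert30, rfl, rfl, by decide +kernel, check30⟩,
    ⟨cert31, rfl, rfl, by decide +kernel, check31⟩,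
    ⟨cert32, rfl, rfl, by decide +kernel, check32⟩,
    ⟨cert33, rfl, rfl, by decide +kernel, check33⟩,
    ⟨cert34, rfl, rfl, by decide +kernel, check34⟩,
    ⟨cert35, rfl, rfl, by decide +kernel, check35⟩,
    ⟨cert36, rfl, rfl, by decide +kernel, check36⟩,
    ⟨cert37, rfl, rfl, by decide +kernel, check37⟩,
    ⟨cert38, rfl, rfl, by decide +kernel, check38⟩,
    ⟨cert39, rfl, rfl, by decide +kernel, check39⟩,
    ⟨cert40, rfl, rfl, by decide +kernel, check40⟩,
    ⟨cert41, rfl, rfl, by decide +kernel, check41⟩,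
    ⟨cert42, rfl, rfl, by decide +kernel, check42⟩,
    ⟨cert43, rfl, rfl, by decide +kernel, check43⟩,
    ⟨cert44, rfl, rfl, by decide +kernel, check44⟩,
    ⟨cert45, rfl, rfl, by decide +kernel, check45⟩,
    ⟨cert46, rfl, rfl, by decide +kernel, check46⟩,
    ⟨cert48, rfl, rfl, by decide +kernel, check48⟩,
    ⟨cert49, rfl, rfl, by decide +kernel, check49⟩,
    ⟨cert50, rfl, rfl, by decide +kernel, check50⟩,
    ⟨cert51, rfl, rfl, by decide +kernel, check51⟩,
    ⟨cert52, rfl, rfl, by decide +kernel, check52⟩,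
    ⟨cert53, rfl, rfl, by decide +kernel, check53⟩,
    ⟨cert55, rfl, rfl, by decide +kernel, check55⟩]

/-- **THE UNIFORM N−1 SWITCHING SENTENCE (35/35), MODEL MV-3, New England SP column LF.** For EVERY
switchable branch `k` (class 1) and EVERY damping / load-frequency vector `D > 0` there are certificate data
`C` (`R = 10⁻⁶`, `τγ = 21/100`, `c ≤ 123/100`, check passed) and a synchronous angle vector `θ` of the post-switch
model `paramsOpen k D` (branch `k` opened at `t = 0` WITHOUT fault; injections `P⁰ := f(δ₀)`, inertias and `D`
KEPT): all 49 power-flow equations exactly, `θ` within `10⁻⁶` rad of the typed half-angle point `halfAngle C.t1`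
(pinned at G1's internal node), every coupled branch inside `2·arctan(21/100) ≈ 23.72°`; and EVERY solution of the
post-switch model from the PRE-switch synchronous state (`δ(0) = δ₀`, zero machine frequency deviations) keeps
Vu–Turitsyn's polytope and `V(θ; δ, δ̇) ≤ c ≤ 123/100` for all `t ≥ 0`, converges to `θ + κ·1`
(`κ = Σ Dᵢ(δ₀ᵢ − θᵢ)/Σ Dᵢ`) and has every machine frequency deviation `→ 0`. No sentence here says the New
England system is stable or N−1 secure. [cite: VuTuritsyn2016, §IV, §VI; Padiyar2013, App. D] -/
theorem n1_switch_resync (k : Fin 56) (hk : k ∈ switchable) (D : Fin 49 → ℝ) (hD : ∀ i, 0 < D i) :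
    ∃ C : Cert 49 56, C.R = 1 / 1000000 ∧ C.τγ = 21 / 100 ∧ C.c ≤ 123/100 ∧
      C.check NE39SP.srcV NE39SP.tgtV NE39SP.wtLFQ (wOpen k) NE39SP.tLFQ 39 ∧
      ∃ θ : Fin 49 → ℝ,
        θ 39 = halfAngle (fun i => (C.t1 i : ℝ)) 39 ∧
        (∀ i, |θ i - halfAngle (fun i => (C.t1 i : ℝ)) i| < (C.R : ℝ)) ∧
        (∀ i, (paramsOpen k D).pe θ i = (paramsOpen k D).P0 i) ∧
        (∀ i j, i ≠ j → (paramsOpen k D).b i j ≠ 0 → |θ i - θ j| < 2 * Real.arctan (C.τγ : ℝ)) ∧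
        ∀ δ : ℝ → Fin 49 → ℝ, (paramsOpen k D).IsSolution δ → δ 0 = NE39SP.δ₀ →
          (∀ i ∈ NE39SP.genS, deriv (fun u => δ u i) 0 = 0) →
          (∀ t, 0 ≤ t →
              (∀ i j, (paramsOpen k D).b i j ≠ 0 → |(δ t i - δ t j) + (θ i - θ j)| < π) ∧
                (paramsOpen k D).energy θ (δ t) (fun i => deriv (fun u => δ u i) t) ≤ (C.c : ℝ)) ∧
            Tendsto δ atTop (𝓝 fun i => θ i + (∑ j, D j * (NE39SP.δ₀ j - θ j)) / ∑ j, D j) ∧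
            ∀ i ∈ NE39SP.genS, Tendsto (fun t => deriv (fun u => δ u i) t) atTop (𝓝 0) := by
  obtain ⟨C, hR, hτ, hc, hchk⟩ := exists_cert_of_mem_switchable k hk
  exact ⟨C, hR, hτ, hc, hchk, switch_resync_open hchk D hD⟩

/-! ### A uniform transient bound: machine speeds -/

/-- **Machine-speed bound from the energy level** (generic, MODEL MV-3): for well-formed data with susceptive
couplings, an angle vector `θ` with `|θᵢ − θⱼ| ≤ π/2` on coupled pairs, and a state `(δ, ω)` in the closed
polytope `|(δᵢ − δⱼ) + (θᵢ − θⱼ)| ≤ π` with `V(θ; δ, ω) ≤ c`: every machine has `|ωᵢ| ≤ √(2c/Mᵢ)` (the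
potential is `≥ 0` there, so the kinetic energy is `≤ c`). [folklore] -/
theorem speed_le_of_energy_le {n : ℕ} {p : Params n} (hp : p.WellFormed) (hb : ∀ i j, 0 ≤ p.b i j)
    {θ : Fin n → ℝ} (h0 : ∀ i j, p.b i j ≠ 0 → |θ i - θ j| ≤ π / 2) {δ ω : Fin n → ℝ}
    (hP : ∀ i j, p.b i j ≠ 0 → |(δ i - δ j) + (θ i - θ j)| ≤ π) {c : ℝ} (hV : p.energy θ δ ω ≤ c) :
    ∀ i ∈ p.gen, |ω i| ≤ Real.sqrt (2 * c / p.M i) := by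
  intro i hi
  have hW0 : 0 ≤ p.potential θ δ := p.potential_nonneg hb h0 hP
  have hKc : p.kinetic ω ≤ c := by unfold Params.energy at hV; linarith
  have hMi := hp.M_pos i hi
  have h1 := p.half_M_mul_sq_le_kinetic (fun j hj => (hp.M_pos j hj).le) ω hi
  refine Real.abs_le_sqrt ?_
  rw [le_div_iff₀ hMi]
  nlinarith

/-- **N−1 transient machine-speed bound (35/35).** In the situation of `n1_switch_resync`: along every solution of
the post-switch model from the pre-switch synchronous state, EVERY machine frequency deviation satisfies
`|δ̇ᵢ(t)| ≤ √(2c/Mᵢ)` for all `t ≥ 0`, with the branch's certified level `c ≤ 123/100` and the printed inertia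
`Mᵢ = 2Hᵢ/ω_s` — a certified bound on the speed excursion of the switching transient of MODEL MV-3 (not a
frequency-nadir claim about any grid). [cite: VuTuritsyn2016, §IV; Padiyar2013, §3.2 eq (3.11)] -/
theorem n1_machine_speed_bound (k : Fin 56) (hk : k ∈ switchable) (D : Fin 49 → ℝ) (hD : ∀ i, 0 < D i) :
    ∃ C : Cert 49 56, C.c ≤ 123/100 ∧ C.check NE39SP.srcV NE39SP.tgtV NE39SP.wtLFQ (wOpen k) NE39SP.tLFQ 39 ∧
      ∃ θ : Fin 49 → ℝ, (∀ i, (paramsOpen k D).pe θ i = (paramsOpen k D).P0 i) ∧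
        ∀ δ : ℝ → Fin 49 → ℝ, (paramsOpen k D).IsSolution δ → δ 0 = NE39SP.δ₀ →
          (∀ i ∈ NE39SP.genS, deriv (fun u => δ u i) 0 = 0) →
          ∀ t, 0 ≤ t → ∀ i ∈ NE39SP.genS,
            |deriv (fun u => δ u i) t| ≤ Real.sqrt (2 * (C.c : ℝ) / (NE39SP.MQ i : ℝ)) := by
  obtain ⟨C, -, hτ, hc, hchk, θ, -, -, heq, hcoh, hdyn⟩ := n1_switch_resync k hk D hD
  refine ⟨C, hc, hchk, θ, heq, fun δ hδ hδ0 hv0 t ht i hi => ?_⟩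
  obtain ⟨hstay, -, -⟩ := hdyn δ hδ hδ0 hv0
  obtain ⟨hpol, hV⟩ := hstay t ht
  have hbnn : ∀ i j, 0 ≤ (paramsOpen k D).b i j := fun i j => by
    rw [paramsOpen_b]
    exact symmetrize_nonneg (edgeWeight_nonneg fun e => by
      have := ((show C.check _ _ _ _ _ _ from hchk).2.1 e).2.1; exact_mod_cast this) i j
  have hτ1 : (C.τγ : ℝ) < 1 := by rw [hτ]; norm_num
  have h0 : ∀ i j, (paramsOpen k D).b i j ≠ 0 → |θ i - θ j| ≤ π / 2 := by
    intro i j hij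
    by_cases h : i = j
    · subst h
      rw [sub_self, abs_zero]
      positivity
    · exact ((hcoh i j h hij).trans (two_mul_arctan_lt_pi_div_two hτ1)).le
  have := speed_le_of_energy_le (paramsOpen_wellFormed k hD) hbnn h0
    (fun i j hij => (hpol i j hij).le) hV i (by rw [paramsOpen_gen]; exact hi)
  have hM : (paramsOpen k D).M i = (NE39SP.MQ i : ℝ) := rfl
  rw [hM] at this
  exact this

end Summit.Ventures.GridStability.Bench.NE39SP

end
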